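import Literature.NumberTheory.EllipticCurves.NeronIsogenyScalingLayerLevelsProofs
import Literature.NumberTheory.EllipticCurves.KodairaNeronUnramifiedProofs
import HarnessLib

/-!
# Points over an unramified layer `K_v(ζ)`: the index of the level subgroups is at most
# `#T · (2qⁿ + 1) · q^{n(N-1)}`

`Proofs` file (theorems only, no definitions, no named facts) in topic
`NumberTheory/EllipticCurves`; second local step of the proof of the named fact
`Literature.NumberTheory.EllipticCurves.integral_neronScaling_of_isGloballyMinimal`
(`NeronIsogenyScaling.lean`) by counting points over the unramified layers `K_n = K_v(ζ)` of
`K̄_v` (architecture in the module docstring of `NeronIsogenyScalingProofs.lean`; first step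
`NeronIsogenyScalingLayerLevelsProofs.lean`). For a MINIMAL Weierstrass equation `X/K_v` of an
elliptic curve and the group `E(K_n)` of its points with coordinates in the layer (the range `Rg`
of `Point.map (val K_n)` inside `X(K̄_v)`), the chain

  `E(K_n) ⊇ E₀(K_n) ⊇ E₁(K_n) = E⁽ρ⁾(K_n) ⊇ E⁽ρ²⁾(K_n) ⊇ ⋯ ⊇ E⁽ρᴺ⁾(K_n)`

(`E₀` = points with nonsingular reduction on an `𝒪_w`-model, `ReductionHomomorphism`; `E₁` its
kernel of reduction = `FormalGroupChart.kernel`; `E⁽ᵗ⁾ = FormalGroupChart.level`, `ρ = |ϖ|_v`) has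

* `[E(K_n) : E₀(K_n)] ≤ #T` — **Kodaira–Néron over `K_v^{nr}`** (the tree's PROVED named fact
  `kodairaNeron_exists_finset_reducesToNonsingular_holds`, Silverman *AEC* VII.6.1/6.2 over
  `K^{nr}`, *ATAEC* IV.9.2(d)): layer points are fixed by the inertia group (`ζ` has order prime
  to `p`), and the finite set `T` of representatives does not depend on `n`;
* `[E₀(K_n) : E₁(K_n)] ≤ 2qⁿ + 1` — the reduction homomorphism `E₀ → Ẽ_ns(k̄)` (*AEC* VII.2.1)
  has kernel `E₁` and, on layer points, image in the points with `x̄ ∈ 𝔽_{qⁿ}` (residues of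
  layer integers are `0` or powers of `ζ̄`), at most two for each `x̄`;
* `[E⁽ρʲ⁾(K_n) : E⁽ρʲ⁺¹⁾(K_n)] ≤ qⁿ` for `j ≥ 1` (`relIndex_level_succ_inf_range_le`, step one),

whence **`[E(K_n) : E⁽ρᴺ⁾(K_n)] ≤ #T · (2qⁿ + 1) · q^{n(N-1)}`**, all indices finite
(`exists_relIndex_level_inf_range_le`). This is the upper bound on the TARGET side of the
isogeny in the counting argument.

## References

* [SilvermanAEC2009] J. H. Silverman, *The Arithmetic of Elliptic Curves*, 2nd ed., GTM 106
  (2009): Prop. VII.2.1 (reduction homomorphism, `E₀/E₁ ↪ Ẽ_ns(k)`), Prop. VII.2.2, Thm. VII.6.1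
  and Cor. VII.6.2 (finiteness of `E(K^{nr})/E₀(K^{nr})`).
* [SilvermanATAEC1994] J. H. Silverman, *Advanced Topics in the Arithmetic of Elliptic Curves*,
  GTM 151 (1994): Cor. IV.9.2(d).
* [SerreLocalFields1979] J.-P. Serre, *Local Fields*, GTM 67 (1979): IV §4 Prop. 16.

## Design

Theorems only (D-0026); setting, notation and hypotheses verbatim those of
`NeronIsogenyScalingLayerLevelsProofs`; the subgroups `E₀ ⊇ E₁` of `X(K̄_v)` are the preimages
of `nonsingularReductionSubgroup` / `kernelOfReduction` of the `𝒪_w`-model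
`integralModel 𝒪_w (X ⊗ K̄_v)` under the identity transport `Affine.Point.congrEquiv`, exactly
as in `exists_nsmul_hasNonsingularReduction_of_kodairaNeron`; local `notation3` abbreviates the
recurring expressions (no definitions are introduced).
-/

noncomputable section

open scoped Classical NNReal Pointwise
open NumberField IsDedekindDomain Polynomial

universe u

namespace IsDedekindDomain.HeightOneSpectrum

open Literature.NumberTheory.EllipticCurves Literature.NumberTheory.GaloisRepresentations Field
  Literature.NumberTheory.EllipticCurves.FormalGroupChart

variable {K : Type u} [Field K] [NumberField K] {v : HeightOneSpectrum (𝓞 K)}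
  {w : Valuation (AlgebraicClosure (v.adicCompletion K)) ℝ≥0}
  (hw : ∀ x, (w x : ℝ) = spectralNorm (v.adicCompletion K) (AlgebraicClosure (v.adicCompletion K)) x)
  {𝔐 : Ideal v.localAbsIntegers} (h𝔐 : 𝔐 ∈ v.localPrimesAbove)
  {F : absoluteGaloisGroup (v.adicCompletion K)}
  (hF : IsArithFrobAt (v.adicCompletionIntegers K) F 𝔐)
  {r : w.integer →+* AlgebraicClosure (IsLocalRing.ResidueField (v.adicCompletionIntegers K))}
  (hr : ∀ a : w.integer, r a = 0 ↔ w (a : AlgebraicClosure (v.adicCompletion K)) < 1)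
  (hrF : ∀ (z : w.integer) (h : w (F • (z : AlgebraicClosure (v.adicCompletion K))) ≤ 1),
    r ⟨F • (z : AlgebraicClosure (v.adicCompletion K)), h⟩ =
      r z ^ Nat.card (IsLocalRing.ResidueField (v.adicCompletionIntegers K)))
  {ϖ : v.adicCompletionIntegers K} (hϖ : Irreducible ϖ)
  {n : ℕ} (hn : n ≠ 0) {ζ : AlgebraicClosure (v.adicCompletion K)}
  (hζ : IsPrimitiveRoot ζ (Nat.card (IsLocalRing.ResidueField (v.adicCompletionIntegers K)) ^ n - 1))
  (X : WeierstrassCurve (v.adicCompletion K))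
  [hV : (X.baseChange (AlgebraicClosure (v.adicCompletion K))).IsIntegral w.integer]

/-- `K̄_v`. -/
local notation3 "𝕃" => AlgebraicClosure (v.adicCompletion K)
/-- `q = #k_v`. -/
local notation3 "𝔮" => Nat.card (IsLocalRing.ResidueField (v.adicCompletionIntegers K))
/-- `ρ = |ϖ|_v`. -/
local notation3 "ρ" => w (algebraMap (v.adicCompletion K) (AlgebraicClosure (v.adicCompletion K))
  (ϖ : v.adicCompletion K))
/-- The layer points `E(K_n) ≤ X(K̄_v)`. -/
local notation3 "Rg" => (WeierstrassCurve.Affine.Point.map (W' := X)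
  (IntermediateField.val (IntermediateField.adjoin (v.adicCompletion K) {ζ}))).range
/-- `E₀ ≤ X(K̄_v)`: points with nonsingular reduction on the `𝒪_w`-model. -/
local notation3 "E₀X" => AddSubgroup.comap
  (WeierstrassCurve.Affine.Point.congrEquiv (WeierstrassCurve.baseChange_integralModel_eq w.integer
    (X.baseChange (AlgebraicClosure (v.adicCompletion K)))).symm).toAddMonoidHom
  ((WeierstrassCurve.integralModel w.integer (X.baseChange (AlgebraicClosure (v.adicCompletion K)))
    ).nonsingularReductionSubgroup (Valuation.integer.integers w))

/-! ## Layer points are fixed by every `σ` fixing `ζ`, in particular by inertia -/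

include hn hζ in
omit hV in
/-- A point with coordinates in `K_n = K_v(ζ)` is fixed by every `σ ∈ Γ_{K_v}` with `σ ζ = ζ`.
[folklore] -/
theorem map_eq_self_of_smul_eq_of_mem_range
    {P : (X.baseChange 𝕃).toAffine.Point} (hP : P ∈ Rg)
    {σ : absoluteGaloisGroup (v.adicCompletion K)} (hσ : σ • ζ = ζ) :
    WeierstrassCurve.Affine.Point.map ((absoluteGaloisGroup.toAlgEquiv _ σ :
        𝕃 ≃ₐ[v.adicCompletion K] 𝕃) : 𝕃 →ₐ[v.adicCompletion K] 𝕃) P = P := by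
  have hfix : ∀ x ∈ IntermediateField.adjoin (v.adicCompletion K) {ζ},
      ((absoluteGaloisGroup.toAlgEquiv _ σ : 𝕃 ≃ₐ[v.adicCompletion K] 𝕃) :
        𝕃 →ₐ[v.adicCompletion K] 𝕃) x = x := fun x hx ↦
    algHom_apply_eq_self_of_mem_adjoin (residueCard_pow_sub_one_ne_zero (v := v) hn)
      hζ.pow_eq_one _ hσ hx
  obtain ⟨P₀, rfl⟩ := hP
  rcases P₀ with _ | ⟨x, y, hxy⟩
  · rw [← WeierstrassCurve.Affine.Point.zero_def, map_zero, map_zero]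
  · rw [WeierstrassCurve.Affine.Point.map_some, WeierstrassCurve.Affine.Point.map_some]
    simp only [hfix x x.2, hfix y y.2, IntermediateField.coe_val]

include hw h𝔐 hn hζ in
omit hV in
/-- **Layer points are fixed by the inertia group** `I_𝔐 ≤ Γ_{K_v}`: `ζ` has order `qⁿ - 1`
prime to `p`, so inertia fixes `ζ` (`smul_eq_self_of_mem_inertia_of_pow_eq_one`, Serre *Local
Fields* IV §4 Prop. 16) and hence `K_n` pointwise. [cite: SerreLocalFields1979, Ch. IV §4 Prop. 16] -/
theorem map_eq_self_of_mem_inertia_of_mem_range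
    {P : (X.baseChange 𝕃).toAffine.Point} (hP : P ∈ Rg)
    {σ : absoluteGaloisGroup (v.adicCompletion K)}
    (hσ : σ ∈ 𝔐.inertia (absoluteGaloisGroup (v.adicCompletion K))) :
    WeierstrassCurve.Affine.Point.map ((absoluteGaloisGroup.toAlgEquiv _ σ :
        𝕃 ≃ₐ[v.adicCompletion K] 𝕃) : 𝕃 →ₐ[v.adicCompletion K] 𝕃) P = P :=
  map_eq_self_of_smul_eq_of_mem_range hn hζ X hP
    (smul_eq_self_of_mem_inertia_of_pow_eq_one hw h𝔐 hσ (residueCard_pow_sub_one_ne_zero (v := v) hn)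
      (spectralValuation_natCast_residueCard_pow_sub_one hw hn) hζ.pow_eq_one)

/-! ## `[E(K_n) : E₀(K_n)] ≤ #T` (Kodaira–Néron over `K_v^{nr}`) -/

include hw h𝔐 hn hζ in
omit hV in
/-- **`[E(K_n) : E₀(K_n)] ≤ #T`.** If `T ⊆ X(K̄_v)` is a finite set of representatives of the
inertia-fixed points modulo `E₀` (as provided, for `X/K_v` a minimal equation of an elliptic
curve and independently of `n`, by Kodaira–Néron over `K_v^{nr}`:
`kodairaNeron_exists_finset_reducesToNonsingular_holds`), then the points of `E(K_n)` with
nonsingular reduction have index `≤ #T` (and `≠ 0`) in `E(K_n)`: layer points are inertia-fixed,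
and `T` surjects onto the quotient. [cite: SilvermanAEC2009, Thm. VII.6.1 and Cor. VII.6.2 over `K^{nr}`]
[cite: SilvermanATAEC1994, Cor. IV.9.2(d)] -/
theorem relIndex_nonsingular_inf_range_le_card [hV : (X.baseChange 𝕃).IsIntegral w.integer]
    {T : Finset (X.baseChange 𝕃).toAffine.Point}
    (hT : ∀ P : (X.baseChange 𝕃).toAffine.Point,
      (∀ σ ∈ 𝔐.inertia (absoluteGaloisGroup (v.adicCompletion K)),
        WeierstrassCurve.Affine.Point.map ((absoluteGaloisGroup.toAlgEquiv _ σ :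
            𝕃 ≃ₐ[v.adicCompletion K] 𝕃) : 𝕃 →ₐ[v.adicCompletion K] 𝕃) P = P) →
      ∃ t ∈ T, ReducesToNonsingular w (IsLocalRing.residue w.integer) (P - t)) :
    (E₀X ⊓ Rg).relIndex Rg ≤ T.card ∧ (E₀X ⊓ Rg).relIndex Rg ≠ 0 := by
  -- every layer point is `E₀`-equivalent to some `t ∈ T`
  have hcl : ∀ P : (X.baseChange 𝕃).toAffine.Point, P ∈ Rg → ∃ t ∈ T, P - t ∈ E₀X := by
    intro P hP
    obtain ⟨t, ht, hPt⟩ := hT P (fun σ hσ ↦ map_eq_self_of_mem_inertia_of_mem_range hw h𝔐 hn hζ X hP hσ)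
    refine ⟨t, ht, ?_⟩
    rw [AddSubgroup.mem_comap, WeierstrassCurve.mem_nonsingularReductionSubgroup_iff]
    exact (reducesToNonsingular_iff_hasNonsingularReduction _ _).mp
      ((reducesToNonsingular_congrEquiv_iff _ _ _).mpr hPt)
  -- choose, for each `t ∈ T` meeting `Rg + E₀X`, a layer point in its class
  let N : AddSubgroup ↥(Rg) := (E₀X ⊓ Rg).addSubgroupOf Rg
  let f : T → ↥(Rg) ⧸ N := fun t ↦
    if h : ∃ P : ↥(Rg), (P : (X.baseChange 𝕃).toAffine.Point) - t ∈ E₀X then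
      QuotientAddGroup.mk h.choose else 0
  have hf : Function.Surjective f := by
    intro c
    obtain ⟨P, rfl⟩ := QuotientAddGroup.mk_surjective c
    obtain ⟨t, ht, hPt⟩ := hcl P P.2
    have hex : ∃ P' : ↥(Rg), (P' : (X.baseChange 𝕃).toAffine.Point) - t ∈ E₀X := ⟨P, hPt⟩
    refine ⟨⟨t, ht⟩, ?_⟩
    simp only [f, dif_pos hex]
    rw [QuotientAddGroup.eq]
    refine ⟨?_, (-hex.choose + P).2⟩
    have e : ((-hex.choose + P : ↥(Rg)) : (X.baseChange 𝕃).toAffine.Point) =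
        (P - t) - (hex.choose - t) := by
      rw [AddSubgroup.coe_add, AddSubgroup.coe_neg]; abel
    change ((-hex.choose + P : ↥(Rg)) : (X.baseChange 𝕃).toAffine.Point) ∈ E₀X
    rw [e]
    exact sub_mem hPt hex.choose_spec
  haveI : Finite (↥(Rg) ⧸ N) := Finite.of_surjective f hf
  refine ⟨?_, AddSubgroup.index_ne_zero_of_finite⟩
  calc (E₀X ⊓ Rg).relIndex Rg = Nat.card (↥(Rg) ⧸ N) := rfl
    _ ≤ Nat.card T := Nat.card_le_card_of_surjective f hf
    _ = T.card := by rw [Nat.card_eq_fintype_card, Fintype.card_coe]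

/-! ## `E₁`: the kernel of reduction of the `𝒪_w`-model is `FormalGroupChart.kernel` -/

/-- The preimage of `E₁` of the `𝒪_w`-model (`kernelOfReduction`, `x ∉ 𝒪_w`) under the identity
transport is the kernel of reduction `FormalGroupChart.kernel` (`|x| > 1`). [folklore] -/
theorem mem_comap_kernelOfReduction_iff (P : (X.baseChange 𝕃).toAffine.Point) :
    P ∈ AddSubgroup.comap
      (WeierstrassCurve.Affine.Point.congrEquiv (WeierstrassCurve.baseChange_integralModel_eq
        w.integer (X.baseChange 𝕃)).symm).toAddMonoidHom
      ((WeierstrassCurve.integralModel w.integer (X.baseChange 𝕃)).kernelOfReduction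
        (Valuation.integer.integers w)) ↔ P ∈ kernel w (X.baseChange 𝕃) := by
  have hv0 : w.Integers w.integer := Valuation.integer.integers w
  rcases P with _ | ⟨x, y, h⟩
  · rw [← WeierstrassCurve.Affine.Point.zero_def]
    exact iff_of_true (no_implicit_lambda% (AddSubgroup.zero_mem _))
      (no_implicit_lambda% (AddSubgroup.zero_mem _))
  · rw [AddSubgroup.mem_comap, AddEquiv.coe_toAddMonoidHom,
      WeierstrassCurve.Affine.Point.congrEquiv_some, WeierstrassCurve.mem_kernelOfReduction_iff,
      WeierstrassCurve.reducesToZero_some_iff, not_mem_range_iff hv0, some_mem_kernel_iff]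

include hw h𝔐 hϖ hn hζ in
/-- **`E₁(K_n) = E⁽ρ⁾(K_n)`**: on layer points the kernel of reduction is the first level
(`val_zCoord_le_of_mem_range`: the value group of `K_n` is that of `K_v`).
[cite: SilvermanAEC2009, Prop. VII.2.2] -/
theorem level_inf_range_eq_kernel_inf_range :
    level w (X.baseChange 𝕃) ρ ⊓ Rg = kernel w (X.baseChange 𝕃) ⊓ Rg := by
  refine le_antisymm (inf_le_inf_right _ (level_le_kernel _)) fun P hP ↦ ⟨?_, hP.2⟩
  exact mem_level_iff.mpr ⟨hP.1, val_zCoord_le_of_mem_range hw h𝔐 hϖ hn hζ X hP.1 hP.2⟩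

/-! ## `[E₀(K_n) : E₁(K_n)] ≤ 2qⁿ + 1` (the reduction homomorphism) -/

include hw h𝔐 hF hr hrF hϖ hn hζ in
omit hV in
/-- Residues of `w`-integral elements of the layer `K_n` lie in `𝔽_{qⁿ} = {0} ∪ {ζ̄ⁱ}` (a set of
at most `qⁿ` elements of the residue field of `𝒪_w`): `residue_div_uniformizer_pow_mem` (with
`j = 0`) for the residue map `r`, transported to `IsLocalRing.residue 𝒪_w` (both have kernel
`𝔪_w`). [folklore] -/
theorem residue_mem_of_mem_adjoin {a : w.integer}
    (ha : (a : 𝕃) ∈ IntermediateField.adjoin (v.adicCompletion K) {ζ}) :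
    IsLocalRing.residue w.integer a ∈
      insert (0 : IsLocalRing.ResidueField w.integer)
        ((Finset.range (𝔮 ^ n - 1)).image (fun i : ℕ ↦
          IsLocalRing.residue w.integer ⟨ζ, spectralValuation_le_one_of_isPrimitiveRoot hn hζ⟩ ^ i)) := by
  have hz : w (a : 𝕃) ≤ ρ ^ 0 := by rw [pow_zero]; exact a.2
  have hmem := residue_div_uniformizer_pow_mem hw h𝔐 hF hr hrF hϖ hn hζ ha hz
  have e : (⟨(a : 𝕃) / algebraMap (v.adicCompletion K) 𝕃 (ϖ : v.adicCompletion K) ^ 0,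
      spectralValuation_div_uniformizer_pow_le_one hw hϖ hz⟩ : w.integer) = a :=
    Subtype.ext (by change (a : 𝕃) / _ = a; rw [pow_zero, div_one])
  rw [congrArg r e] at hmem
  -- `residue x = residue y ↔ w (x - y) < 1 ↔ r x = r y`
  have key : ∀ x y : w.integer, r x = r y →
      IsLocalRing.residue w.integer x = IsLocalRing.residue w.integer y := by
    intro x y hxy
    rw [← sub_eq_zero, ← map_sub, IsLocalRing.residue_eq_zero_iff, IsLocalRing.mem_maximalIdeal,
      mem_nonunits_iff, Valuation.Integer.not_isUnit_iff_valuation_lt_one]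
    exact (hr _).mp (by rw [map_sub, hxy, sub_self])
  rcases Finset.mem_insert.mp hmem with h0 | hi
  · refine Finset.mem_insert.mpr (Or.inl ?_)
    rw [← map_zero (IsLocalRing.residue w.integer)]
    exact key _ _ (by rw [h0, map_zero])
  · obtain ⟨i, hi, he⟩ := Finset.mem_image.mp hi
    refine Finset.mem_insert.mpr (Or.inr (Finset.mem_image.mpr ⟨i, hi, ?_⟩))
    rw [← map_pow]
    exact key _ _ (by rw [map_pow, he])

include hw h𝔐 hF hr hrF hϖ hn hζ in
/-- **`[E₀(K_n) : E₁(K_n)] ≤ 2qⁿ + 1`, and the index is finite.** The reduction homomorphism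
`E₀ → Ẽ_ns(k̄)` of the `𝒪_w`-model (Silverman *AEC* VII.2.1, `reductionHom`) restricted to the
layer points has kernel `E₁(K_n)` (`reductionHom_ker`) and image inside the points `(x̄, ȳ)` with
`x̄ ∈ 𝔽_{qⁿ}` (`residue_mem_of_mem_adjoin`), at most two for each `x̄` (`ȳ` is a root of a monic
quadratic), together with `Õ`. [cite: SilvermanAEC2009, Prop. VII.2.1] -/
theorem relIndex_kernel_inf_range_le :
    (kernel w (X.baseChange 𝕃) ⊓ Rg).relIndex (E₀X ⊓ Rg) ≤ 2 * 𝔮 ^ n + 1 ∧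
      (kernel w (X.baseChange 𝕃) ⊓ Rg).relIndex (E₀X ⊓ Rg) ≠ 0 := by
  have hv0 : w.Integers w.integer := Valuation.integer.integers w
  -- notation
  let W₀ : WeierstrassCurve w.integer := WeierstrassCurve.integralModel w.integer (X.baseChange 𝕃)
  have hW₀ : X.baseChange 𝕃 = W₀.baseChange 𝕃 :=
    (WeierstrassCurve.baseChange_integralModel_eq w.integer (X.baseChange 𝕃)).symm
  let k := IsLocalRing.ResidueField w.integer
  let res : w.integer →+* k := IsLocalRing.residue w.integer
  let H : AddSubgroup (X.baseChange 𝕃).toAffine.Point := E₀X ⊓ Rg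
  -- the reduction homomorphism on `H`
  let ι : ↥H →+ ↥(W₀.nonsingularReductionSubgroup hv0) :=
    AddMonoidHom.codRestrict ((WeierstrassCurve.Affine.Point.congrEquiv hW₀).toAddMonoidHom.comp
      H.subtype) _ (fun P ↦ P.2.1)
  let red : ↥H →+ (W₀.map res).toAffine.Point := (W₀.reductionHom hv0).comp ι
  have hred : ∀ P : ↥H, red P = W₀.reducePoint
      (WeierstrassCurve.Affine.Point.congrEquiv hW₀ (P : (X.baseChange 𝕃).toAffine.Point)) :=
    fun P ↦ rfl
  -- its kernel is `E₁(K_n)`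
  have hmemE₀ : ∀ P : ↥H, W₀.HasNonsingularReduction
      (WeierstrassCurve.Affine.Point.congrEquiv hW₀ (P : (X.baseChange 𝕃).toAffine.Point)) :=
    fun P ↦ P.2.1
  have hker : red.ker = (kernel w (X.baseChange 𝕃) ⊓ Rg).addSubgroupOf H := by
    ext P
    rw [AddMonoidHom.mem_ker, AddSubgroup.mem_addSubgroupOf, hred,
      WeierstrassCurve.reducePoint_eq_zero_iff hv0 (hmemE₀ P), AddSubgroup.mem_inf,
      ← mem_comap_kernelOfReduction_iff X]
    exact ⟨fun h ↦ ⟨h, P.2.2⟩, fun h ↦ h.1⟩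
  -- the finite set receiving the image: `Õ` and the `(x̄, ȳ)` with `x̄ ∈ 𝔽_{qⁿ}`
  let Sx : Finset k := insert (0 : k) ((Finset.range (𝔮 ^ n - 1)).image (fun i : ℕ ↦
    res ⟨ζ, spectralValuation_le_one_of_isPrimitiveRoot hn hζ⟩ ^ i))
  let Qd : k → k[X] := fun x ↦ C 1 * Polynomial.X ^ 2 +
    C ((W₀.map res).toAffine.a₁ * x + (W₀.map res).toAffine.a₃) * Polynomial.X +
    C (-(x ^ 3 + (W₀.map res).toAffine.a₂ * x ^ 2 + (W₀.map res).toAffine.a₄ * x +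
      (W₀.map res).toAffine.a₆))
  have hQd : ∀ x, (Qd x).natDegree = 2 := fun x ↦ natDegree_quadratic one_ne_zero
  have hroot : ∀ {x y : k}, (W₀.map res).toAffine.Equation x y → y ∈ (Qd x).roots.toFinset := by
    intro x y he
    have hne : Qd x ≠ 0 := fun h ↦ by have := hQd x; rw [h, natDegree_zero] at this; exact two_ne_zero this.symm
    rw [Multiset.mem_toFinset, mem_roots hne, IsRoot.def]
    rw [WeierstrassCurve.Affine.equation_iff] at he
    simp only [Qd, eval_add, eval_mul, eval_C, eval_pow, eval_X]
    linear_combination he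
  let T' : Finset (Option (k × k)) :=
    insert none ((Sx.biUnion fun x ↦ ((Qd x).roots.toFinset.image (Prod.mk x))).image some)
  have hT'card : T'.card ≤ 2 * 𝔮 ^ n + 1 := by
    have hq1 : 1 ≤ 𝔮 ^ n := Nat.one_le_pow _ _ (Nat.pos_of_ne_zero (by
      haveI : Finite (IsLocalRing.ResidueField (v.adicCompletionIntegers K)) :=
        finite_residueField_adicCompletionIntegers K v
      exact Nat.card_pos.ne'))
    have hSx : Sx.card ≤ 𝔮 ^ n := by
      refine (Finset.card_insert_le _ _).trans ?_
      refine (Nat.add_le_add_right Finset.card_image_le 1).trans ?_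
      rw [Finset.card_range]; omega
    have hfib : ∀ x ∈ Sx, (((Qd x).roots.toFinset.image (Prod.mk x))).card ≤ 2 := by
      intro x _
      refine Finset.card_image_le.trans ((Multiset.toFinset_card_le _).trans ?_)
      exact (card_roots' _).trans (hQd x).le
    calc T'.card ≤ ((Sx.biUnion fun x ↦ ((Qd x).roots.toFinset.image (Prod.mk x))).image some).card + 1 :=
          Finset.card_insert_le _ _
      _ ≤ (Sx.biUnion fun x ↦ ((Qd x).roots.toFinset.image (Prod.mk x))).card + 1 :=
          Nat.add_le_add_right Finset.card_image_le 1
      _ ≤ (∑ x ∈ Sx, (((Qd x).roots.toFinset.image (Prod.mk x))).card) + 1 :=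
          Nat.add_le_add_right Finset.card_biUnion_le 1
      _ ≤ (∑ _x ∈ Sx, 2) + 1 := Nat.add_le_add_right (Finset.sum_le_sum hfib) 1
      _ = 2 * Sx.card + 1 := by rw [Finset.sum_const, smul_eq_mul, mul_comm]
      _ ≤ 2 * 𝔮 ^ n + 1 := by omega
  -- coordinates of a reduced point
  let g : (W₀.map res).toAffine.Point → Option (k × k) := fun Q ↦
    match Q with
    | .zero => none
    | .some x y _ => some (x, y)
  have hg : Function.Injective g := by
    rintro (_ | ⟨x, y, h⟩) (_ | ⟨x', y', h'⟩) he
    · rfl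
    · exact (Option.some_ne_none _ he.symm).elim
    · exact (Option.some_ne_none _ he).elim
    · simp only [g, Option.some.injEq, Prod.mk.injEq] at he
      obtain ⟨rfl, rfl⟩ := he
      rfl
  -- the image of `red` lands in `T'`
  have himage : ∀ P : ↥H, g (red P) ∈ T' := by
    intro P
    obtain ⟨P₀, hP₀⟩ := P.2.2
    rw [hred]
    rcases P₀ with _ | ⟨x₀, y₀, h₀⟩
    · rw [← WeierstrassCurve.Affine.Point.zero_def, map_zero] at hP₀
      rw [← hP₀, map_zero, WeierstrassCurve.reducePoint_zero]
      exact Finset.mem_insert_self _ _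
    rw [WeierstrassCurve.Affine.Point.map_some] at hP₀
    rw [← hP₀, WeierstrassCurve.Affine.Point.congrEquiv_some]
    have h₀X : (X.baseChange 𝕃).toAffine.Nonsingular (x₀ : 𝕃) (y₀ : 𝕃) :=
      (WeierstrassCurve.Affine.baseChange_nonsingular (W := X)
        (f := IntermediateField.val (IntermediateField.adjoin (v.adicCompletion K) {ζ}))
        Subtype.val_injective x₀ y₀).mpr h₀
    have h₀' : (W₀.baseChange 𝕃).toAffine.Nonsingular (x₀ : 𝕃) (y₀ : 𝕃) := hW₀ ▸ h₀X
    by_cases hx : w (x₀ : 𝕃) ≤ 1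
    · -- integral point `(a, b)`, `a, b ∈ 𝒪_w`, with `ā ∈ 𝔽_{qⁿ}`
      have hy : w (y₀ : 𝕃) ≤ 1 := v_Y_le_one_of_v_X_le_one hv0 h₀'.1 hx
      have hab : (W₀.baseChange 𝕃).toAffine.Nonsingular (algebraMap w.integer 𝕃 ⟨x₀, hx⟩)
          (algebraMap w.integer 𝕃 ⟨y₀, hy⟩) := h₀'
      change g (W₀.reducePoint (.some _ _ hab)) ∈ T'
      by_cases hns : (W₀.map res).toAffine.Nonsingular (res ⟨x₀, hx⟩) (res ⟨y₀, hy⟩)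
      · rw [WeierstrassCurve.reducePoint_some_algebraMap hv0.hom_inj hab hns]
        refine Finset.mem_insert_of_mem (Finset.mem_image.mpr ⟨(res ⟨x₀, hx⟩, res ⟨y₀, hy⟩), ?_, rfl⟩)
        refine Finset.mem_biUnion.mpr ⟨res ⟨x₀, hx⟩, ?_, Finset.mem_image.mpr ⟨_, hroot hns.1, rfl⟩⟩
        exact residue_mem_of_mem_adjoin hw h𝔐 hF hr hrF hϖ hn hζ x₀.2
      · rw [WeierstrassCurve.reducePoint_some_algebraMap_of_not hv0.hom_inj hab hns]
        exact Finset.mem_insert_self _ _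
    · change g (W₀.reducePoint (.some (x₀ : 𝕃) (y₀ : 𝕃) h₀')) ∈ T'
      rw [WeierstrassCurve.reducePoint_some_of_not_mem _ ((not_mem_range_iff hv0).mpr (not_le.mp hx))]
      exact Finset.mem_insert_self _ _
  -- count
  let G : ↥red.range → ↥(T' : Set (Option (k × k))) := fun Q ↦
    ⟨g Q.1, by obtain ⟨P, hP⟩ := Q.2; rw [← hP]; exact himage P⟩
  have hG : Function.Injective G := by
    intro Q Q' he
    apply Subtype.ext
    apply hg
    simpa only [G, Subtype.mk.injEq] using he
  haveI : Finite ↥red.range := Finite.of_injective G hG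
  have hidx : (kernel w (X.baseChange 𝕃) ⊓ Rg).relIndex (E₀X ⊓ Rg) = Nat.card ↥red.range := by
    rw [AddSubgroup.relIndex, ← hker, AddSubgroup.index_ker]
  rw [hidx]
  refine ⟨?_, Nat.card_ne_zero.mpr ⟨⟨0, zero_mem _⟩, inferInstance⟩⟩
  calc Nat.card ↥red.range ≤ Nat.card ↥(T' : Set (Option (k × k))) := Nat.card_le_card_of_injective G hG
    _ = T'.card := Nat.card_eq_finsetCard T'
    _ ≤ 2 * 𝔮 ^ n + 1 := hT'card

/-! ## The chain: `[E(K_n) : E⁽ρᴺ⁾(K_n)] ≤ #T · (2qⁿ + 1) · q^{n(N-1)}` -/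

/-- `E₁ ≤ E₀` for the transported subgroups of `X(K̄_v)`. [cite: SilvermanAEC2009, Prop. VII.2.1] -/
theorem kernel_le_comap_nonsingularReductionSubgroup : kernel w (X.baseChange 𝕃) ≤ E₀X := by
  intro P hP
  have hP' := (mem_comap_kernelOfReduction_iff X P).mpr hP
  rw [AddSubgroup.mem_comap] at hP' ⊢
  exact WeierstrassCurve.kernelOfReduction_le_nonsingularReductionSubgroup _ hP'

include hw h𝔐 hF hr hrF hϖ hn hζ in
/-- **`[E₁(K_n) : E⁽ρ^{1+d}⁾(K_n)] ≤ q^{nd}`**, finite: the product of the successive indices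
`[E⁽ρʲ⁾(K_n) : E⁽ρʲ⁺¹⁾(K_n)] ≤ qⁿ` (`relIndex_level_succ_inf_range_le`).
[cite: SilvermanAEC2009, Prop. IV.3.2(a) with Prop. VII.2.2] -/
theorem relIndex_level_inf_range_level_one_le (d : ℕ) :
    (level w (X.baseChange 𝕃) (ρ ^ (1 + d)) ⊓ Rg).relIndex (level w (X.baseChange 𝕃) (ρ ^ 1) ⊓ Rg) ≤
        𝔮 ^ (n * d) ∧
      (level w (X.baseChange 𝕃) (ρ ^ (1 + d)) ⊓ Rg).relIndex
        (level w (X.baseChange 𝕃) (ρ ^ 1) ⊓ Rg) ≠ 0 := by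
  have hρ := spectralValuation_uniformizer_pos_lt_one hw hϖ
  induction d with
  | zero => rw [add_zero, AddSubgroup.relIndex_self, mul_zero, pow_zero]; exact ⟨le_rfl, one_ne_zero⟩
  | succ d ih =>
    have hHK : level w (X.baseChange 𝕃) (ρ ^ (1 + d + 1)) ⊓ Rg ≤
        level w (X.baseChange 𝕃) (ρ ^ (1 + d)) ⊓ Rg :=
      inf_le_inf_right _ (level_mono (pow_le_pow_right_of_le_one' hρ.2.le (by omega)))
    have hKL : level w (X.baseChange 𝕃) (ρ ^ (1 + d)) ⊓ Rg ≤ level w (X.baseChange 𝕃) (ρ ^ 1) ⊓ Rg :=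
      inf_le_inf_right _ (level_mono (pow_le_pow_right_of_le_one' hρ.2.le (by omega)))
    have hstep := relIndex_level_succ_inf_range_le hw h𝔐 hF hr hrF hϖ hn hζ X (j := 1 + d) (by omega)
    rw [show 1 + (d + 1) = 1 + d + 1 by ring, ← AddSubgroup.relIndex_mul_relIndex _ _ _ hHK hKL]
    refine ⟨?_, mul_ne_zero hstep.2 ih.2⟩
    calc _ ≤ 𝔮 ^ n * 𝔮 ^ (n * d) := Nat.mul_le_mul hstep.1 ih.1
      _ = 𝔮 ^ (n * (d + 1)) := by rw [← pow_add]; ring_nf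

include hw h𝔐 hF hr hrF hϖ hn hζ in
/-- **`[E(K_n) : E⁽ρᴺ⁾(K_n)] ≤ #T · (2qⁿ + 1) · q^{n(N-1)}`** for `N ≥ 1`, and the index is
finite, granted a finite set `T` of representatives of the inertia-fixed points of `X(K̄_v)`
modulo `E₀` (Kodaira–Néron over `K_v^{nr}`): the chain
`E(K_n) ⊇ E₀(K_n) ⊇ E₁(K_n) = E⁽ρ⁾(K_n) ⊇ ⋯ ⊇ E⁽ρᴺ⁾(K_n)` and the three bounds
`relIndex_nonsingular_inf_range_le_card`, `relIndex_kernel_inf_range_le`,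
`relIndex_level_inf_range_level_one_le`.
[cite: SilvermanAEC2009, Prop. VII.2.1, Prop. VII.2.2, Cor. VII.6.2] -/
theorem relIndex_level_inf_range_le_card
    {T : Finset (X.baseChange 𝕃).toAffine.Point}
    (hT : ∀ P : (X.baseChange 𝕃).toAffine.Point,
      (∀ σ ∈ 𝔐.inertia (absoluteGaloisGroup (v.adicCompletion K)),
        WeierstrassCurve.Affine.Point.map ((absoluteGaloisGroup.toAlgEquiv _ σ :
            𝕃 ≃ₐ[v.adicCompletion K] 𝕃) : 𝕃 →ₐ[v.adicCompletion K] 𝕃) P = P) →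
      ∃ t ∈ T, ReducesToNonsingular w (IsLocalRing.residue w.integer) (P - t))
    {N : ℕ} (hN : 1 ≤ N) :
    (level w (X.baseChange 𝕃) (ρ ^ N) ⊓ Rg).relIndex Rg ≤
        T.card * ((2 * 𝔮 ^ n + 1) * 𝔮 ^ (n * (N - 1))) ∧
      (level w (X.baseChange 𝕃) (ρ ^ N) ⊓ Rg).relIndex Rg ≠ 0 := by
  obtain ⟨d, rfl⟩ : ∃ d, N = 1 + d := ⟨N - 1, by omega⟩
  have h3 := relIndex_level_inf_range_level_one_le hw h𝔐 hF hr hrF hϖ hn hζ X d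
  have h2 := relIndex_kernel_inf_range_le hw h𝔐 hF hr hrF hϖ hn hζ X
  have h1 := relIndex_nonsingular_inf_range_le_card hw h𝔐 hn hζ X hT
  have hE₁ : level w (X.baseChange 𝕃) (ρ ^ 1) ⊓ Rg = kernel w (X.baseChange 𝕃) ⊓ Rg := by
    rw [pow_one]; exact level_inf_range_eq_kernel_inf_range hw h𝔐 hϖ hn hζ X
  rw [hE₁] at h3
  have hρ := spectralValuation_uniformizer_pos_lt_one hw hϖ
  have hHK : level w (X.baseChange 𝕃) (ρ ^ (1 + d)) ⊓ Rg ≤ kernel w (X.baseChange 𝕃) ⊓ Rg :=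
    inf_le_inf_right _ (level_le_kernel _)
  have hKL : kernel w (X.baseChange 𝕃) ⊓ Rg ≤ E₀X ⊓ Rg :=
    inf_le_inf_right _ (kernel_le_comap_nonsingularReductionSubgroup X)
  have hLM : E₀X ⊓ Rg ≤ Rg := inf_le_right
  rw [← AddSubgroup.relIndex_mul_relIndex _ _ _ hHK (hKL.trans hLM),
    ← AddSubgroup.relIndex_mul_relIndex _ _ _ hKL hLM, Nat.add_sub_cancel_left]
  refine ⟨?_, mul_ne_zero h3.2 (mul_ne_zero h2.2 h1.2)⟩
  calc _ ≤ 𝔮 ^ (n * d) * ((2 * 𝔮 ^ n + 1) * T.card) :=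
        Nat.mul_le_mul h3.1 (Nat.mul_le_mul h2.1 h1.1)
    _ = T.card * ((2 * 𝔮 ^ n + 1) * 𝔮 ^ (n * d)) := by ring

include hw h𝔐 hF hr hrF hϖ in
omit hV in
/-- **The target-side bound of the counting argument.** For `X/K_v` a MINIMAL Weierstrass equation
of an elliptic curve there is a constant `C` (the number of Kodaira–Néron representatives over
`K_v^{nr}`) such that for every unramified layer `K_n = K_v(ζ)` (`ζ` a primitive `(qⁿ - 1)`-th
root of unity, `n ≥ 1`) and every `N ≥ 1`, the layer points of level `ρᴺ` have index at most
`C · (2qⁿ + 1) · q^{n(N-1)}` in `E(K_n)`, the index being finite.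
[cite: SilvermanAEC2009, Prop. VII.2.1, Prop. VII.2.2, Thm. VII.6.1, Cor. VII.6.2]
[cite: SilvermanATAEC1994, Cor. IV.9.2(d)] -/
theorem exists_relIndex_level_inf_range_le [X.IsElliptic] [X.IsMinimal (v.adicCompletionIntegers K)] :
    ∃ C : ℕ, ∀ {n : ℕ}, n ≠ 0 → ∀ {ζ : 𝕃}, IsPrimitiveRoot ζ (𝔮 ^ n - 1) →
      ∀ [(X.baseChange 𝕃).IsIntegral w.integer] {N : ℕ}, 1 ≤ N →
        (level w (X.baseChange 𝕃) (ρ ^ N) ⊓ (WeierstrassCurve.Affine.Point.map (W' := X)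
            (IntermediateField.val (IntermediateField.adjoin (v.adicCompletion K) {ζ}))).range).relIndex
            (WeierstrassCurve.Affine.Point.map (W' := X)
              (IntermediateField.val (IntermediateField.adjoin (v.adicCompletion K) {ζ}))).range ≤
          C * ((2 * 𝔮 ^ n + 1) * 𝔮 ^ (n * (N - 1))) ∧
        (level w (X.baseChange 𝕃) (ρ ^ N) ⊓ (WeierstrassCurve.Affine.Point.map (W' := X)
            (IntermediateField.val (IntermediateField.adjoin (v.adicCompletion K) {ζ}))).range).relIndex
            (WeierstrassCurve.Affine.Point.map (W' := X)
              (IntermediateField.val (IntermediateField.adjoin (v.adicCompletion K) {ζ}))).range ≠ 0 := by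
  obtain ⟨T, -, hT⟩ := X.kodairaNeron_exists_finset_reducesToNonsingular_holds w hw h𝔐
  exact ⟨T.card, fun hn _ hζ _ _ hN ↦ relIndex_level_inf_range_le_card hw h𝔐 hF hr hrF hϖ hn hζ X hT hN⟩

end IsDedekindDomain.HeightOneSpectrum

end
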